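import Mathlib
import Summits.Ventures.PercRepro2.Defs
import Summits.Ventures.PercRepro2.Graph
import Summits.Ventures.PercRepro2.OneColourSwitch
import Summits.Ventures.PercRepro2.RegionHubSign
import Summits.Ventures.PercRepro2.SideSwitch
import Summits.Ventures.PercRepro2.SideSwitchFibre
import Summits.Ventures.PercRepro2.SideSwitchComps
import Summits.Ventures.PercRepro2.M9NoPocketDefs
import Summits.Ventures.PercRepro2.M9NoPocketWorld
import Summits.Ventures.PercRepro2.M9NoPocketWorldD
import Summits.Ventures.PercRepro2.M9NoPocketLegal
import Summits.Ventures.PercRepro2.M9NoPocketMono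
import Summits.Ventures.PercRepro2.M9NoPocketCompl
import Summits.Ventures.PercRepro2.M9NoPocketCompl2
import Summits.Ventures.PercRepro2.M9NoPocketFlipRS
import Summits.Ventures.PercRepro2.M9NoPocketHarris
import Summits.Ventures.PercRepro2.M9PsiOneDefs
import Summits.Ventures.PercRepro2.M9NoPocketFreeBlock
import Summits.Ventures.PercRepro2.M9NoPocketFreeBlockK
import Summits.Ventures.PercRepro2.M9NoPocketDeadMono
import Summits.Ventures.PercRepro2.M9NoPocketDeadY
import Summits.Ventures.PercRepro2.M9QuadHarrisPow
import Summits.Ventures.PercRepro2.M9UnitAlgebra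
import Summits.Ventures.PercRepro2.M9NoPocketSameType
import Summits.Ventures.PercRepro2.M9NoPocketDeadPattern
import Summits.Ventures.PercRepro2.M9NoPocketLinkCompl
import Summits.Ventures.PercRepro2.M9NoPocketLinkE
import Summits.Ventures.PercRepro2.M9NoPocketSigmaRS
import Summits.Ventures.PercRepro2.M9NoPocketUnitE

/-!
# The one-sided part of a unit: one dead pattern (blind cell PercRepro2, p3 g36, 2026-08-29;
`proofs/P3-NPHDR.md` §5(e), in the unit form)

For a same-type representative `ρ₀`, its outside flip `ρ₁` and a dead pattern `D ≠ A`, the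
`K`-points `κ_ρ(D, T)` (`T` free) of the two representatives carry the sign
`σ_rs = [T ∩ 𝔉L = ∅] − [𝔉L ⊆ T](1 − ℓK D)` (`sigma_rs_K_eq_common`), so their sign sum is
`A_D − (1 − ℓK D)·B_D` with `A_D`, `B_D` the `σ_pq` sums over the block sets missing /
containing the linking free blocks (`K_add_K_eq`).  Two bounds: a dirty point lies below its
clean point (`M9NoPocketDeadMono`), and the clean points' `σ_pq` sum is `HY ∅ − HW 𝔑` by the
complement identity, so `A_D ≤ HY ∅ − HW 𝔑` (`A_le`); dead edges do not change `p ~_Y q`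
(`M9NoPocketDeadY`) and `p ~_W q` only decreases when more free blocks are switched, so
`A_D − B_D ≤ HY ∅ − HW ∅` (`A_sub_B_le`).  Hence **the one-sided sum of the pattern is at most
`ℓK D · (HY ∅ − HW 𝔑)`** (`K_add_K_le`).  Own work; std axioms.
-/

namespace Summit.Ventures.PercRepro2

namespace NoPocket

open Finset Classical RegionHub OneColourSwitch SideSwitch M9Reduce

variable {V : Type*} {E : Type*}

section UnitK

variable [Fintype V] [DecidableEq V] [Fintype E] [DecidableEq E] {ends : E → Sym2 V}

omit [Fintype E] [DecidableEq E] in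
/-- A vertex lies in at most one block. -/
lemma blocks_eq_of_shared_vertex {d r s : V} {ρ : Config E} {C C' : Finset V} (hC : C ∈ blocks ends d r s ρ)
    (hC' : C' ∈ blocks ends d r s ρ) {y : V} (hy : y ∈ C) (hy' : y ∈ C') : C = C' := by
  rw [eq_compIn_of_mem_comps (ends := endsD ends d) hC hy,
    eq_compIn_of_mem_comps (ends := endsD ends d) hC' hy']

omit [DecidableEq E] in
/-- An edge of `d` into a joined block does not touch the union of a set of free blocks. -/
lemma edge_at_d_not_touches_free {d r s : V} (hnp : NoPocketAt ends d r s) (hr : d ≠ r)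
    (hs : d ≠ s) (hT : Tset ends d r s = ∅) (hloop : ∀ e, ends e ≠ s(d, d)) {ρ : Config E}
    (hst : ∀ e, d ∈ ends e → ρ e = true) {T : Finset (Finset V)}
    (hTf : T ⊆ (blocks ends d r s ρ).filter (fun C => ¬ hasY ends d ρ C)) {e : E}
    (he : d ∈ ends e) : e ∉ touches ends (↑(unionT T) : Set V) := by
  obtain ⟨C, hC, y, hyC, hends⟩ := exists_block_of_edge_at_d hnp hr hs hT hloop ρ he
  rintro ⟨w, hw, z, hwz⟩
  obtain ⟨C', hC', hwC'⟩ := mem_unionT.1 (Finset.mem_coe.1 hw)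
  obtain ⟨hC'b, hC'Y⟩ := Finset.mem_filter.1 (hTf hC')
  have hwe : w ∈ ends e := by rw [hwz]; exact Sym2.mem_mk_left _ _
  rw [hends, Sym2.mem_iff] at hwe
  rcases hwe with rfl | rfl
  · exact d_notMem_block hr hs hC'b hwC'
  · have : C = C' := blocks_eq_of_shared_vertex hC hC'b hyC hwC'
    subst this
    exact hC'Y ((hasY_sameType_iff hst C).2 ⟨e, w, hyC, hends⟩)

omit [Fintype V] [Fintype E] in
/-- The empty dead pattern is the representative. -/
lemma flipF_empty (ρ : Config E) : flipF (∅ : Finset E) ρ = ρ := by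
  funext e
  simp [flipF]

omit [Fintype V] [Fintype E] in
/-- A `K`-point of a dead pattern agrees with the clean point off the edges at `d`. -/
lemma assignX_flipF_eq_off_d {d : V} {ρ : Config E} {D : Finset E} (hD : ∀ e ∈ D, d ∈ ends e)
    (T : Finset (Finset V)) {e : E} (he : d ∉ ends e) :
    assignX ends (T, ∅) (flipF D ρ) e = assignX ends (T, ∅) ρ e := by
  have heD : e ∉ D := fun h => he (hD e h)
  simp only [assignX, flipTouch, flipF, Finset.notMem_empty, if_false, heD]

/-- For a pattern `D ≠ A`, `d` has a `Y`-source at every `K`-point. -/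
lemma srcY_K_of_ne {d r s : V} (hnp : NoPocketAt ends d r s) (hr : d ≠ r) (hs : d ≠ s)
    (hT : Tset ends d r s = ∅) (hloop : ∀ e, ends e ≠ s(d, d)) {ρ : Config E}
    (hst : ∀ e, d ∈ ends e → ρ e = true) {D : Finset E}
    (hD : D ⊆ univ.filter (fun e => d ∈ ends e)) (hDA : D ≠ univ.filter (fun e => d ∈ ends e))
    {T : Finset (Finset V)}
    (hTf : T ⊆ (blocks ends d r s ρ).filter (fun C => ¬ hasY ends d ρ C)) :
    srcY ends d r s (flipF D ρ) (T, ∅) := by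
  have hDd : ∀ e ∈ D, d ∈ ends e := fun e he => (Finset.mem_filter.1 (hD he)).2
  obtain ⟨e, he, heD⟩ := Finset.exists_of_ssubset (Finset.ssubset_iff_subset_ne.2 ⟨hD, hDA⟩)
  have hed : d ∈ ends e := (Finset.mem_filter.1 he).2
  obtain ⟨C, hC, y, hyC, hends⟩ := exists_block_of_edge_at_d hnp hr hs hT hloop ρ hed
  have hCb : C ∈ blocks ends d r s (flipF D ρ) := by
    rw [blocks_flipF (ends := ends) (r := r) (s := s) (ρ := ρ) hDd]; exact hC
  refine Or.inr ⟨C, hCb, ?_, (hasY_flipF_iff hst D C).2 ⟨e, heD, y, hyC, hends⟩⟩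
  intro hCT
  exact (Finset.mem_filter.1 (hTf hCT)).2 ((hasY_sameType_iff hst C).2 ⟨e, y, hyC, hends⟩)

/-- **The `Y`-connection of a `K`-point is that of its clean point** (dead edges do not
matter). -/
lemma conn_pq_K_iff {p q r s d : V} (hnp : NoPocketAt ends d r s) (hpd : p ≠ d) (hqd : q ≠ d)
    (hr : d ≠ r) (hs : d ≠ s) (hT : Tset ends d r s = ∅) (hloop : ∀ e, ends e ≠ s(d, d))
    {ρ : Config E} (hρ : ρ ∈ RepD ends p q r s d) (hst : ∀ e, d ∈ ends e → ρ e = true)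
    {D : Finset E} (hD : D ⊆ univ.filter (fun e => d ∈ ends e))
    (hDA : D ≠ univ.filter (fun e => d ∈ ends e)) {T : Finset (Finset V)}
    (hTf : T ⊆ (blocks ends d r s ρ).filter (fun C => ¬ hasY ends d ρ C)) :
    Conn ends (assignX ends (T, ∅) (flipF D ρ)) p q ↔ Conn ends (assignX ends (T, ∅) ρ) p q := by
  have hDd : ∀ e ∈ D, d ∈ ends e := fun e he => (Finset.mem_filter.1 (hD he)).2
  have hρD := flipF_mem_RepD hρ hT hDd
  have hx : ((T, ∅) : Finset (Finset V) × Finset E) ∈ L4 ends d r s ρ :=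
    (mem_L4_sameType_iff hT hst).2 ⟨hTf.trans (Finset.filter_subset _ _), rfl⟩
  have hxD := mem_L4_flipF_of_free hst hDd hTf
  have hsep := (mem_DOneSet.1 (mem_DOneSet_assignX_of_mem_L4 hnp hpd hqd hr hs hρ hx)).1
  have hsepD := (mem_DOneSet.1 (mem_DOneSet_assignX_of_mem_L4 hnp hpd hqd hr hs hρD hxD)).1
  have hdK : d ∈ K2 ends r s (assignX ends (T, ∅) ρ) :=
    (d_mem_K2_assignX_iff_srcY hnp hr hs hρ hx).2
      (by
        have h0 : (∅ : Finset E) ⊆ univ.filter (fun e => d ∈ ends e) := Finset.empty_subset _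
        have hne : (∅ : Finset E) ≠ univ.filter (fun e => d ∈ ends e) := by
          intro h
          obtain ⟨e, he, _⟩ := Finset.exists_of_ssubset
            (Finset.ssubset_iff_subset_ne.2 ⟨hD, hDA⟩)
          rw [← h] at he
          exact Finset.notMem_empty e he
        have := srcY_K_of_ne hnp hr hs hT hloop hst h0 hne hTf
        rw [flipF_empty] at this
        exact this)
  have hdKD : d ∈ K2 ends r s (assignX ends (T, ∅) (flipF D ρ)) :=
    (d_mem_K2_assignX_iff_srcY hnp hr hs hρD hxD).2 (srcY_K_of_ne hnp hr hs hT hloop hst hD hDA hTf)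
  exact conn_pq_iff_of_eqOn_off_d (not_mem_K2_of_sep2 hsep).1 hdK (not_mem_K2_of_sep2 hsepD).1
    hdKD (fun e he => (assignX_flipF_eq_off_d hDd T he).symm)

/-- **`p ~_W q` at a `K`-point only decreases when more free blocks are switched.** -/
lemma conn_compl_K_anti {p q r s d : V} (hnp : NoPocketAt ends d r s) (hpd : p ≠ d)
    (hqd : q ≠ d) (hr : d ≠ r) (hs : d ≠ s) (hT : Tset ends d r s = ∅)
    (hrs : ∀ e, ends e ≠ s(r, s)) {ρ : Config E} (hρ : ρ ∈ RepD ends p q r s d)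
    (hst : ∀ e, d ∈ ends e → ρ e = true) {D : Finset E} (hD : ∀ e ∈ D, d ∈ ends e)
    {T T' : Finset (Finset V)} (hTT' : T ⊆ T')
    (hT'f : T' ⊆ (blocks ends d r s ρ).filter (fun C => ¬ hasY ends d ρ C))
    (h : Conn ends (OneColourSwitch.compl (assignX ends (T', ∅) (flipF D ρ))) p q) :
    Conn ends (OneColourSwitch.compl (assignX ends (T, ∅) (flipF D ρ))) p q := by
  have hρD := flipF_mem_RepD hρ hT hD
  have hb := blocks_flipF (ends := ends) (r := r) (s := s) (ρ := ρ) hD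
  have hTf : T ⊆ (blocks ends d r s ρ).filter (fun C => ¬ hasY ends d ρ C) := hTT'.trans hT'f
  have hTb : T ⊆ blocks ends d r s (flipF D ρ) := by
    rw [hb]; exact hTf.trans (Finset.filter_subset _ _)
  have hT'b : T' ⊆ blocks ends d r s (flipF D ρ) := by
    rw [hb]; exact hT'f.trans (Finset.filter_subset _ _)
  rw [conn_compl_assignX_iff hnp hr hs hT hrs hρD hTb p q]
  rw [conn_compl_assignX_iff hnp hr hs hT hrs hρD hT'b p q] at h
  have hρO := flipOp_mem_RepD hr hs hρD
  have hx := mem_L4_flipF_of_free hst hD hTf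
  have hx' := mem_L4_flipF_of_free hst hD hT'f
  have hc := cdual_mem_L4 hx
  have hc' := cdual_mem_L4 hx'
  rw [cdual_pair_eq hT] at hc hc'
  rw [← L4_flipOp hr hs] at hc hc'
  refine conn_pq_assignX_mono hnp hpd hqd hr hs hρO ?_ hc' hc h
  exact Prod.le_def.2 ⟨Finset.sdiff_subset_sdiff (Finset.Subset.refl _) hTT', le_rfl⟩

/-- **The sign `σ_rs` of a `K`-point of either representative**, in the sets and the link
indicator of `ρ₀`. -/
theorem sigma_rs_K_eq_common {p q r s d : V} (hnp : NoPocketAt ends d r s) (hr : d ≠ r)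
    (hs : d ≠ s) (hT : Tset ends d r s = ∅) (hloop : ∀ e, ends e ≠ s(d, d))
    (hrs : ∀ e, ends e ≠ s(r, s)) (hrs' : r ≠ s) {ρ₀ : Config E}
    (hρ₀ : ρ₀ ∈ RepD ends p q r s d) (hst : ∀ e, d ∈ ends e → ρ₀ e = true) {ρ : Config E}
    (hρ : ρ = ρ₀ ∨ ρ = flipOp ends d r s ρ₀) {D : Finset E} (hD : ∀ e ∈ D, d ∈ ends e)
    {𝔉 𝔉L : Finset (Finset V)}
    (h𝔉 : 𝔉 = (blocks ends d r s ρ₀).filter (fun C => ¬ hasY ends d ρ₀ C))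
    (h𝔉L : 𝔉L = 𝔉.filter (LinksIn ends ρ₀ r s)) {T : Finset (Finset V)} (hTf : T ⊆ 𝔉) :
    sigma ends (assignX ends (T, ∅) (flipF D ρ)) r s =
      (if T ∩ 𝔉L = ∅ then 1 else 0) - (if 𝔉L ⊆ T then 1 else 0) *
        (1 - (if Conn ends (assignX ends (𝔉, ∅) (flipF D ρ₀)) r s then 1 else 0)) := by
  subst h𝔉L
  rcases hρ with rfl | rfl
  · have h := sigma_rs_K_eq hnp hr hs hT hrs hrs' hρ₀ hst hD (h𝔉 ▸ hTf)
    rw [← h𝔉] at h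
    exact h
  · have hρ₁ := flipOp_mem_RepD hr hs hρ₀
    have hst₁ := sameType_flipOp hnp hr hs hT hloop hρ₀ hst
    have hTf₁ : T ⊆ (blocks ends d r s (flipOp ends d r s ρ₀)).filter
        (fun C => ¬ hasY ends d (flipOp ends d r s ρ₀) C) := by
      rw [filter_free_flipOp hr hs, ← h𝔉]; exact hTf
    have h := sigma_rs_K_eq hnp hr hs hT hrs hrs' hρ₁ hst₁ hD hTf₁
    rw [filter_links_flipOp hr hs, filter_free_flipOp hr hs, ← h𝔉, ← flipOp_flipF ρ₀ hD] at h
    have hL : ((𝔉, ∅) : Finset (Finset V) × Finset E) ∈ L4 ends d r s (flipF D ρ₀) :=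
      mem_L4_flipF_of_free hst hD (h𝔉 ▸ Finset.Subset.refl _)
    have hρD := flipF_mem_RepD hρ₀ hT hD
    rw [← flipOp_flipF ρ₀ hD, h]
    simp only [conn_rs_assignX_flipOp_iff hnp hr hs hρD hL]

/-- **The one-sided sum of a dead pattern** collected by the side of the linking free blocks. -/
theorem K_add_K_eq {p q r s d : V} (hnp : NoPocketAt ends d r s) (hr : d ≠ r) (hs : d ≠ s)
    (hT : Tset ends d r s = ∅) (hloop : ∀ e, ends e ≠ s(d, d)) (hrs : ∀ e, ends e ≠ s(r, s))
    (hrs' : r ≠ s) {ρ₀ : Config E} (hρ₀ : ρ₀ ∈ RepD ends p q r s d)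
    (hst : ∀ e, d ∈ ends e → ρ₀ e = true) {D : Finset E} (hD : ∀ e ∈ D, d ∈ ends e)
    {𝔉 𝔉L : Finset (Finset V)}
    (h𝔉 : 𝔉 = (blocks ends d r s ρ₀).filter (fun C => ¬ hasY ends d ρ₀ C))
    (h𝔉L : 𝔉L = 𝔉.filter (LinksIn ends ρ₀ r s)) :
    (∑ T ∈ 𝔉.powerset, sigma ends (assignX ends (T, ∅) (flipF D ρ₀)) p q *
        sigma ends (assignX ends (T, ∅) (flipF D ρ₀)) r s) +
      (∑ T ∈ 𝔉.powerset, sigma ends (assignX ends (T, ∅) (flipF D (flipOp ends d r s ρ₀))) p q *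
        sigma ends (assignX ends (T, ∅) (flipF D (flipOp ends d r s ρ₀))) r s) =
      (∑ T ∈ 𝔉.powerset.filter (fun T => T ∩ 𝔉L = ∅),
          (sigma ends (assignX ends (T, ∅) (flipF D ρ₀)) p q +
            sigma ends (assignX ends (T, ∅) (flipF D (flipOp ends d r s ρ₀))) p q)) -
        (1 - (if Conn ends (assignX ends (𝔉, ∅) (flipF D ρ₀)) r s then 1 else 0)) *
          (∑ T ∈ 𝔉.powerset.filter (fun T => 𝔉L ⊆ T),
            (sigma ends (assignX ends (T, ∅) (flipF D ρ₀)) p q +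
              sigma ends (assignX ends (T, ∅) (flipF D (flipOp ends d r s ρ₀))) p q)) := by
  rw [← sum_K_algebra 𝔉 𝔉L
    (fun T => sigma ends (assignX ends (T, ∅) (flipF D ρ₀)) p q +
      sigma ends (assignX ends (T, ∅) (flipF D (flipOp ends d r s ρ₀))) p q),
    ← Finset.sum_add_distrib]
  refine Finset.sum_congr rfl (fun T hTp => ?_)
  have hTf : T ⊆ 𝔉 := Finset.mem_powerset.1 hTp
  rw [sigma_rs_K_eq_common hnp hr hs hT hloop hrs hrs' hρ₀ hst (Or.inl rfl) hD h𝔉 h𝔉L hTf,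
    sigma_rs_K_eq_common hnp hr hs hT hloop hrs hrs' hρ₀ hst (Or.inr rfl) hD h𝔉 h𝔉L hTf]
  ring

/-- **The dirty points lie below the clean ones: `A_D ≤ HY ∅ − HW 𝔑`.** -/
theorem A_le {p q r s d : V} (hnp : NoPocketAt ends d r s) (hr : d ≠ r) (hs : d ≠ s)
    (hT : Tset ends d r s = ∅) (hloop : ∀ e, ends e ≠ s(d, d)) (hrs : ∀ e, ends e ≠ s(r, s))
    {ρ₀ : Config E} (hρ₀ : ρ₀ ∈ RepD ends p q r s d) (hst : ∀ e, d ∈ ends e → ρ₀ e = true)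
    {D : Finset E} (hD : ∀ e ∈ D, d ∈ ends e) {𝔉 𝔑 𝔉L : Finset (Finset V)}
    (h𝔉 : 𝔉 = (blocks ends d r s ρ₀).filter (fun C => ¬ hasY ends d ρ₀ C))
    (h𝔑 : 𝔑 = (blocks ends d r s ρ₀).filter (hasY ends d ρ₀))
    (h𝔉L : 𝔉L = 𝔉.filter (LinksIn ends ρ₀ r s)) :
    (∑ T ∈ 𝔉.powerset.filter (fun T => T ∩ 𝔉L = ∅),
        (sigma ends (assignX ends (T, ∅) (flipF D ρ₀)) p q +
          sigma ends (assignX ends (T, ∅) (flipF D (flipOp ends d r s ρ₀))) p q)) ≤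
      (∑ T ∈ 𝔉.powerset.filter (fun T => T ∩ 𝔉L = ∅),
          ((if Conn ends (assignX ends (T ∪ ∅, ∅) ρ₀) p q then 1 else 0) +
            (if Conn ends (assignX ends (T ∪ ∅, ∅) (flipOp ends d r s ρ₀)) p q then 1 else 0))) -
        (∑ T ∈ 𝔉.powerset.filter (fun T => 𝔉L ⊆ T),
          ((if Conn ends (assignX ends (T ∪ 𝔑, ∅) ρ₀) p q then 1 else 0) +
            (if Conn ends (assignX ends (T ∪ 𝔑, ∅) (flipOp ends d r s ρ₀)) p q
              then 1 else 0))) := by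
  have hρ₁ := flipOp_mem_RepD hr hs hρ₀
  have hst₁ := sameType_flipOp hnp hr hs hT hloop hρ₀ hst
  have hLf : 𝔉L ⊆ 𝔉 := by rw [h𝔉L]; exact Finset.filter_subset _ _
  -- step 1: each dirty point is below its clean point
  have h1 : ∀ T ∈ 𝔉.powerset.filter (fun T => T ∩ 𝔉L = ∅),
      sigma ends (assignX ends (T, ∅) (flipF D ρ₀)) p q +
          sigma ends (assignX ends (T, ∅) (flipF D (flipOp ends d r s ρ₀))) p q ≤
        sigma ends (assignX ends (T, ∅) ρ₀) p q +
          sigma ends (assignX ends (T, ∅) (flipOp ends d r s ρ₀)) p q := by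
    intro T hTp
    have hTf : T ⊆ (blocks ends d r s ρ₀).filter (fun C => ¬ hasY ends d ρ₀ C) := by
      rw [← h𝔉]; exact Finset.mem_powerset.1 (Finset.mem_filter.1 hTp).1
    have hTf₁ : T ⊆ (blocks ends d r s (flipOp ends d r s ρ₀)).filter
        (fun C => ¬ hasY ends d (flipOp ends d r s ρ₀) C) := by
      rw [filter_free_flipOp hr hs]; exact hTf
    have hle : ∀ (ρ : Config E), (∀ e, d ∈ ends e → ρ e = true) →
        T ⊆ (blocks ends d r s ρ).filter (fun C => ¬ hasY ends d ρ C) →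
        assignX ends (T, ∅) (flipF D ρ) ≤ assignX ends (T, ∅) ρ := by
      intro ρ hstρ hTfρ e
      by_cases he : e ∈ D
      · have ht := edge_at_d_not_touches_free hnp hr hs hT hloop hstρ hTfρ (hD e he)
        simp only [assignX, flipTouch, flipF, ht, if_false, Finset.notMem_empty, he, if_true]
        rw [hstρ e (hD e he)]
        exact Bool.false_le _
      · simp only [assignX, flipTouch, flipF, he, if_false, Finset.notMem_empty]
        exact le_rfl
    exact add_le_add (sigma_mono (hle ρ₀ hst hTf) p q) (sigma_mono (hle _ hst₁ hTf₁) p q)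
  refine (Finset.sum_le_sum h1).trans (le_of_eq ?_)
  -- step 2: the clean points' `σ_pq` by the complement identity
  have h2 : ∀ T ∈ 𝔉.powerset.filter (fun T => T ∩ 𝔉L = ∅),
      sigma ends (assignX ends (T, ∅) ρ₀) p q +
          sigma ends (assignX ends (T, ∅) (flipOp ends d r s ρ₀)) p q =
        ((if Conn ends (assignX ends (T ∪ ∅, ∅) ρ₀) p q then 1 else 0) +
          (if Conn ends (assignX ends (T ∪ ∅, ∅) (flipOp ends d r s ρ₀)) p q then 1 else 0)) -
        ((if Conn ends (assignX ends ((𝔉 \ T) ∪ 𝔑, ∅) ρ₀) p q then 1 else 0) +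
          (if Conn ends (assignX ends ((𝔉 \ T) ∪ 𝔑, ∅) (flipOp ends d r s ρ₀)) p q
            then 1 else 0)) := by
    intro T hTp
    have hTf : T ⊆ (blocks ends d r s ρ₀).filter (fun C => ¬ hasY ends d ρ₀ C) := by
      rw [← h𝔉]; exact Finset.mem_powerset.1 (Finset.mem_filter.1 hTp).1
    have hTb : T ⊆ blocks ends d r s ρ₀ := hTf.trans (Finset.filter_subset _ _)
    have hTb₁ : T ⊆ blocks ends d r s (flipOp ends d r s ρ₀) := by
      rw [blocks_flipOp hr hs]; exact hTb
    have hsd : blocks ends d r s ρ₀ \ T = (𝔉 \ T) ∪ 𝔑 := by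
      have := blocks_sdiff_union ρ₀ hTf (S := ∅) (Finset.empty_subset _)
      rw [Finset.union_empty, Finset.sdiff_empty, ← h𝔉, ← h𝔑] at this
      exact this
    have c0 := conn_compl_assignX_iff hnp hr hs hT hrs hρ₀ hTb p q
    have c1 := conn_compl_assignX_iff hnp hr hs hT hrs hρ₁ hTb₁ p q
    rw [hsd] at c0
    rw [blocks_flipOp hr hs, hsd, flipOp_flipOp hr hs] at c1
    rw [Finset.union_empty]
    by_cases a0 : Conn ends (assignX ends (T, ∅) ρ₀) p q <;>
      by_cases a1 : Conn ends (assignX ends (T, ∅) (flipOp ends d r s ρ₀)) p q <;>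
      by_cases b0 : Conn ends (assignX ends ((𝔉 \ T) ∪ 𝔑, ∅) ρ₀) p q <;>
      by_cases b1 : Conn ends (assignX ends ((𝔉 \ T) ∪ 𝔑, ∅) (flipOp ends d r s ρ₀)) p q <;>
      simp only [sigma, c0, c1, a0, a1, b0, b1, if_true, if_false] <;> ring
  rw [Finset.sum_congr rfl h2, Finset.sum_sub_distrib]
  congr 1
  have := sum_filter_inter_empty_eq_sum_sdiff hLf (fun T =>
    (if Conn ends (assignX ends (T ∪ 𝔑, ∅) ρ₀) p q then 1 else 0) +
      (if Conn ends (assignX ends (T ∪ 𝔑, ∅) (flipOp ends d r s ρ₀)) p q then 1 else 0))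
  exact this

end UnitK

end NoPocket

end Summit.Ventures.PercRepro2
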